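import Summits.QuantumFields.YangMills.Theorems.SmallFieldWideningWideningOfTiltAndMassSmallFieldCauchy

/-!
# Route `SmallFieldWidening` — THE EXACT SMALL-FIELD CONTENT OF E3 GIVEN A `K`-UNIFORM LARGE-FIELD MASS
# (support file for item `WideningOfTiltAndMass`, stmt-QuantumFields-22885; seat `ym-line-sfw-p1` gen 8)

The companion file `…SmallFieldCauchy` showed that the widening needs from the small-field side only CAUCHY conditional
expectations given UV-small history (not King's sup-norm tilts).  This file closes the logical gap to an EQUIVALENCE: given
windows `E_K` of the refined families `F.refine n` (`n ≥ n₀`) whose complements have Gibbs mass `≤ δ n`, `δ n → 0` — crux r3's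
shape —, the ORIGINAL family has its full-sequence continuum limit `HasContinuumLimit (F.scheme ℰ γ)` IF AND ONLY IF, at every depth
`n ≥ n₀` and for every label string `Cs`, the conditional expectations `K ↦ ⨍ coarseObs Cs d(A_K)_*(Gibbs_K | E_K)` are
APPROXIMATELY CAUCHY WITH DEFECT `4·δ n`: `∀ ε > 0 ∃ M ∀ K, K' ≥ M, |a_K − a_{K'}| ≤ 4δ n + ε`
(`hasContinuumLimit_iff_condOscillation`; every gauge group `G`, every measurable smearing `ℰ`, any measurable windows).
«⇐» is the Moore–Osgood device for sequences uniformly near APPROXIMATELY Cauchy ones (`cauchySeq_of_forall_near_approxCauchy`);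
«⇒» is the one-law bound `|∫ W dP − ⨍ W dμ| ≤ 2δ` (`WideningSmallFieldCauchy.abs_integral_sub_average_le`) read backwards along
`expectAt_refine`.  On `SU(2)`/`ℰp` with Bałaban's all-heights windows: `continuumYM3Torus_iff_condOscillation` — for ONE family and
coupling carrying r3's body, the E3 target `ContinuumYM3Torus F ℰp γ` is EQUIVALENT to that oscillation condition.  So, modulo r3,
the small-field crux of this route can be typed EXACTLY (necessary and sufficient), strictly below `UnitTiltAt … 0`.

WHAT THIS IS NOT: no estimate, no proof of r2 or r3 (OPEN), no d = 4, no mass gap, no Clay (rung-R3 RECORD plumbing; every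
statement is measure theory + real sequences over tree objects).  Sources: [King1986] Thm 3.4 (3.9)–(3.13) p. 656 (Cauchy in `K`);
[Balaban1985UV3] (7) p. 257 (UV-small histories); the iterated-limit step is folklore.
-/

noncomputable section

open MeasureTheory Filter Topology
open scoped ENNReal
open Literature.MathematicalPhysics.QuantumFieldTheory.Balaban1983to89
open Literature.MathematicalPhysics.QuantumFieldTheory.Balaban1983to89.Missing
open Literature.MathematicalPhysics.QuantumFieldTheory.Balaban1983to89.T3ContinuumYM3Torus
open Literature.MathematicalPhysics.QuantumFieldTheory.Balaban1983to89.T3ThresholdRemoval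
open Literature.MathematicalPhysics.QuantumFieldTheory.Balaban1983to89.T3UnitLawDensityEML (ℰp measurableE_ℰp)
open Literature.MathematicalPhysics.QuantumFieldTheory.Balaban1983to89.T3UnitScaleTilt
open Summit.QuantumFields.YangMills.Theorems.WideningOfTiltAndMass (refine_coupling_pos)
open Summit.QuantumFields.YangMills.Theorems.WideningSmallFieldCauchy (abs_integral_sub_average_le)

namespace Summit.QuantumFields.YangMills.Theorems.WideningSmallFieldIff

/-! ## §1 Real sequences: uniformly near APPROXIMATELY Cauchy sequences ⇒ Cauchy, and back -/

/-- A real sequence `a` such that for every `ε > 0` some shifted tail `K ↦ a (K + n)` is uniformly `ε`-close to a sequence `b` whose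
oscillation is eventually `≤ ε` is Cauchy (`ε/3 + ε/3 + ε/3`; the landed `cauchySeq_of_forall_near_cauchySeq` asked `b` Cauchy). [folklore] -/
theorem cauchySeq_of_forall_near_approxCauchy {a : ℕ → ℝ}
    (h : ∀ ε : ℝ, 0 < ε → ∃ (n : ℕ) (b : ℕ → ℝ) (M : ℕ),
      (∀ K K', M ≤ K → M ≤ K' → |b K - b K'| ≤ ε) ∧ ∀ K, |a (K + n) - b K| ≤ ε) :
    CauchySeq a := by
  refine Metric.cauchySeq_iff.mpr fun ε hε => ?_
  obtain ⟨n, b, M, hb, hnear⟩ := h (ε / 4) (by positivity)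
  refine ⟨M + n, fun m hm k hk => ?_⟩
  obtain ⟨i, rfl⟩ := Nat.exists_eq_add_of_le hm
  obtain ⟨j, rfl⟩ := Nat.exists_eq_add_of_le hk
  have e1 : M + n + i = (M + i) + n := by ring
  have e2 : M + n + j = (M + j) + n := by ring
  rw [e1, e2, Real.dist_eq]
  have h1 := hnear (M + i)
  have h2 := hnear (M + j)
  have h3 := hb (M + i) (M + j) (Nat.le_add_right M i) (Nat.le_add_right M j)
  rw [abs_sub_comm] at h2
  calc |a (M + i + n) - a (M + j + n)|
      = |(a (M + i + n) - b (M + i)) + (b (M + i) - b (M + j)) + (b (M + j) - a (M + j + n))| := by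
        congr 1; ring
    _ ≤ |a (M + i + n) - b (M + i)| + |b (M + i) - b (M + j)| + |b (M + j) - a (M + j + n)| :=
        abs_add_three _ _ _
    _ < ε := by linarith

/-- Conversely: a sequence `b` uniformly `c`-close to a shifted tail of a CAUCHY sequence `a` has oscillation eventually `≤ 2c + ε`. [folklore] -/
theorem approxCauchy_of_near_cauchySeq {a b : ℕ → ℝ} (ha : CauchySeq a) {n : ℕ} {c : ℝ}
    (hnear : ∀ K, |a (K + n) - b K| ≤ c) {ε : ℝ} (hε : 0 < ε) :
    ∃ M : ℕ, ∀ K K', M ≤ K → M ≤ K' → |b K - b K'| ≤ 2 * c + ε := by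
  obtain ⟨M, hM⟩ := Metric.cauchySeq_iff.mp ha ε hε
  refine ⟨M, fun K K' hK hK' => ?_⟩
  have h1 := hnear K
  have h2 := hnear K'
  have h3 := hM (K + n) (hK.trans (Nat.le_add_right K n)) (K' + n) (hK'.trans (Nat.le_add_right K' n))
  rw [Real.dist_eq] at h3
  rw [abs_sub_comm] at h1
  calc |b K - b K'| = |(b K - a (K + n)) + (a (K + n) - a (K' + n)) + (a (K' + n) - b K')| := by congr 1; ring
    _ ≤ |b K - a (K + n)| + |a (K + n) - a (K' + n)| + |a (K' + n) - b K'| := abs_add_three _ _ _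
    _ ≤ 2 * c + ε := by linarith

/-! ## §2 The equivalence: every `G`, every measurable `ℰ`, any windows with `K`-uniform masses `δ n → 0` -/

section Iff

variable (F : T3Family) {G : Type*} [GaugeGroup G] [MeasurableSpace G] [HaarData G] [RegularGaugeGroup G]
  (ℰ : LoopAverage G)

/-- **THE EXACT SMALL-FIELD CONTENT OF THE CONTINUUM LIMIT, GIVEN A `K`-UNIFORM LARGE-FIELD MASS** (every `G`, every measurable `ℰ`,
`γ ≥ 0`): measurable windows `E n K` of the refined families with Gibbs masses of `(E n K)ᶜ` `≤ δ n` for `n ≥ n₀`, `δ n → 0`.  Then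
`HasContinuumLimit (F.scheme ℰ γ)` ⟺ for every depth `n ≥ n₀`, every label string `Cs` and every `ε > 0` the conditional expectations
`a_K = ⨍ coarseObs Cs d(A_K)_*(Gibbs_K | E n K)` satisfy `|a_K − a_{K'}| ≤ 4·δ n + ε` for all large `K, K'`.
«⇒»: `|x_{K+n} − a_K| ≤ 2δ n` (`abs_integral_sub_average_le`, `expectAt_refine`) and `x` is Cauchy; «⇐»: §1 with `n` deep enough that
`δ n ≤ ε/5`.  No crux is proved; this only locates what the small-field side must deliver. [cite: King1986, Thm 3.4 (3.9)-(3.13) p.656] -/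
theorem hasContinuumLimit_iff_condOscillation (hE : ℰ.MeasurableE) {γ : ℝ} (hγ : 0 ≤ γ) (n₀ : ℕ) {δ : ℕ → ℝ}
    (hδ : Tendsto δ atTop (𝓝 0)) (E : ∀ n K, Set (GaugeField ((F.refine n).P K) 0 G))
    (hEm : ∀ n K, MeasurableSet (E n K))
    (hmass : ∀ n K, n₀ ≤ n → (gibbsK (F.refine n) ℰ (γ * ((F.L : ℝ)⁻¹) ^ n) K).real (E n K)ᶜ ≤ δ n) :
    HasContinuumLimit (F.scheme ℰ γ) ↔
      ∀ n : ℕ, n₀ ≤ n → ∀ (Cs : List (ULoop3 F)) (ε : ℝ), 0 < ε → ∃ M : ℕ, ∀ K K', M ≤ K → M ≤ K' →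
        |(⨍ u, coarseObs F n ℰ Cs u ∂Measure.map (unitA (F.refine n) ℰ K)
            ((gibbsK (F.refine n) ℰ (γ * ((F.L : ℝ)⁻¹) ^ n) K).restrict (E n K))) -
          ⨍ u, coarseObs F n ℰ Cs u ∂Measure.map (unitA (F.refine n) ℰ K')
            ((gibbsK (F.refine n) ℰ (γ * ((F.L : ℝ)⁻¹) ^ n) K').restrict (E n K'))| ≤ 4 * δ n + ε := by
  -- the one-law bound at depth `n`, step `K`: `|x_{K+n} − a_K| ≤ 2 δ n`
  have hnear : ∀ n, n₀ ≤ n → ∀ (Cs : List (ULoop3 F)) (K : ℕ),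
      |(F.scheme ℰ γ).expectAt (K + n) Cs -
        ⨍ u, coarseObs F n ℰ Cs u ∂Measure.map (unitA (F.refine n) ℰ K)
          ((gibbsK (F.refine n) ℰ (γ * ((F.L : ℝ)⁻¹) ^ n) K).restrict (E n K))| ≤ 2 * δ n := by
    intro n hn Cs K
    have hγ' : 0 ≤ γ * ((F.L : ℝ)⁻¹) ^ n := mul_nonneg hγ (pow_nonneg (inv_nonneg.mpr (Nat.cast_nonneg _)) n)
    haveI := isProbabilityMeasure_unitLaw (F := F.refine n) (ℰ := ℰ) hE hγ' K
    rw [expectAt_refine F n ℰ hE hγ K Cs]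
    exact abs_integral_sub_average_le (unitLaw_eq_map_restrict_add hE K (hEm n K))
      (by rw [real_map_restrict_univ hE]; exact hmass n K hn)
      (measurable_coarseObs F n ℰ hE Cs) (abs_coarseObs_le_one F n ℰ Cs)
  constructor
  · -- «⇒»
    intro hlim n hn Cs ε hε
    obtain ⟨l, hl⟩ := hlim Cs
    obtain ⟨M, hM⟩ := approxCauchy_of_near_cauchySeq hl.cauchySeq (hnear n hn Cs) hε
    exact ⟨M, fun K K' hK hK' => by linarith [hM K K' hK hK']⟩
  · -- «⇐»
    intro hosc Cs
    suffices hcs : CauchySeq fun K => (F.scheme ℰ γ).expectAt K Cs from cauchySeq_tendsto_of_complete hcs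
    refine cauchySeq_of_forall_near_approxCauchy fun ε hε => ?_
    obtain ⟨n, hn₀, hn⟩ : ∃ n, n₀ ≤ n ∧ δ n < ε / 5 := by
      obtain ⟨n, hn⟩ := ((hδ.eventually (gt_mem_nhds (by positivity : (0 : ℝ) < ε / 5))).and
        (eventually_ge_atTop n₀)).exists
      exact ⟨n, hn.2, hn.1⟩
    obtain ⟨M, hM⟩ := hosc n hn₀ Cs (ε / 5) (by positivity)
    refine ⟨n, fun K => ⨍ u, coarseObs F n ℰ Cs u ∂Measure.map (unitA (F.refine n) ℰ K)
      ((gibbsK (F.refine n) ℰ (γ * ((F.L : ℝ)⁻¹) ^ n) K).restrict (E n K)), M,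
      fun K K' hK hK' => (hM K K' hK hK').trans (by linarith), fun K => (hnear n hn₀ Cs K).trans (by linarith)⟩

end Iff

/-! ## §3 On `SU(2)`/`ℰp` with the all-heights windows: E3 for one family ⟺ the oscillation condition, given r3's body -/

section Leaf

/-- **E3 FOR ONE FAMILY AND COUPLING ⟺ THE SMALL-FIELD OSCILLATION CONDITION, GIVEN r3's BODY** (`SU(2)`, printed smearing `ℰp`,
`γ > 0`): if ONE sequence `δ n → 0` bounds, for `n ≥ n₀`, the Gibbs masses of the complements of the all-heights UV-small-history
events of ALL runs of `F.refine n` at `γL^{-n}` (what crux r3 `LargeFieldMassRefinementTail` delivers below its `γ₁`), then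
`ContinuumYM3Torus F ℰp γ` (existence ∧ uniqueness ∧ RP ∧ covariance) holds IF AND ONLY IF at every depth `n ≥ n₀` the conditional
expectations of every original loop product GIVEN ALL-HEIGHTS UV-SMALL HISTORY are approximately Cauchy with defect `4·δ n`.  Hence,
modulo r3, the small-field crux of this route is EXACTLY this condition — implied by `UnitTiltAt … 0` (companion file, defect `0`),
by its total-variation typing, and necessary.  CONDITIONAL; no crux, no summit, no mass gap. [cite: King1986, Thm 3.4 (3.9)-(3.13) p.656] -/
theorem continuumYM3Torus_iff_condOscillation (F : T3Family) {γ b₀ p₀ : ℝ} (hγ : 0 < γ) (n₀ : ℕ) {δ : ℕ → ℝ}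
    (hδ : Tendsto δ atTop (𝓝 0))
    (hmass : ∀ n K : ℕ, n₀ ≤ n → (gibbsK (F.refine n) ℰp (γ * ((F.L : ℝ)⁻¹) ^ n) K).real
      (histGood (F.refine n) ℰp (θBal (F.refine n).L (γ * ((F.L : ℝ)⁻¹) ^ n) b₀ p₀) K 0)ᶜ ≤ δ n) :
    ContinuumYM3Torus F ℰp γ ↔
      ∀ n : ℕ, n₀ ≤ n → ∀ (Cs : List (ULoop3 F)) (ε : ℝ), 0 < ε → ∃ M : ℕ, ∀ K K', M ≤ K → M ≤ K' →
        |(⨍ u, coarseObs F n ℰp Cs u ∂Measure.map (unitA (F.refine n) ℰp K)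
            ((gibbsK (F.refine n) ℰp (γ * ((F.L : ℝ)⁻¹) ^ n) K).restrict
              (histGood (F.refine n) ℰp (θBal (F.refine n).L (γ * ((F.L : ℝ)⁻¹) ^ n) b₀ p₀) K 0))) -
          ⨍ u, coarseObs F n ℰp Cs u ∂Measure.map (unitA (F.refine n) ℰp K')
            ((gibbsK (F.refine n) ℰp (γ * ((F.L : ℝ)⁻¹) ^ n) K').restrict
              (histGood (F.refine n) ℰp (θBal (F.refine n).L (γ * ((F.L : ℝ)⁻¹) ^ n) b₀ p₀) K' 0))| ≤ 4 * δ n + ε :=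
  (continuumYM3Torus_iff_hasContinuumLimit_SU F ℰp measurableE_ℰp hγ.le).trans
    (hasContinuumLimit_iff_condOscillation F ℰp measurableE_ℰp hγ.le n₀ hδ
      (fun n K => histGood (F.refine n) ℰp (θBal (F.refine n).L (γ * ((F.L : ℝ)⁻¹) ^ n) b₀ p₀) K 0)
      (fun n K => measurableSet_histGood (F.refine n) ℰp measurableE_ℰp _ K 0) (fun n K hn => hmass n K hn))

/-- **THE RUNG-R3 LEAF, GIVEN r3 AS FILED, IS EQUIVALENT TO «r3's BODY BUNDLED WITH THE OSCILLATION CONDITION»**: under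
`LargeFieldMassRefinementTail`, `YM3TorusSU2` ⟺ there is `γ₁ > 0` such that every family `F` and `0 < γ ≤ γ₁` carry a profile, a depth
`n₀` and ONE `δ n → 0` bounding the all-heights complement masses of all runs of `F.refine n` (`n ≥ n₀`) for which the conditional
expectations of every loop product given all-heights UV-small history are approximately Cauchy with defect `4·δ n`.  «⇒» takes the
leaf's `γ₁`, r3's profile and mass sequence at `L = F.L` (depth `n₀` with `γL^{-n} ≤ γ₁(L)`, `exists_depth_le`) and reads the oscillation
off `continuumYM3Torus_iff_condOscillation`; «⇐» is that equivalence backwards (r3 unused).  CONDITIONAL on r3 (OPEN); it proves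
neither r2 nor the leaf; no summit, no mass gap. [cite: King1986, Thm 3.4 (3.9)-(3.13) p.656] -/
theorem ym3TorusSU2_iff_massAndCondOscillation
    (hM : Summit.QuantumFields.YangMills.Theses.SmallFieldWidening.LargeFieldMassRefinementTail) :
    Literature.MathematicalPhysics.QuantumFieldTheory.Balaban1983to89.T3YM3TorusStatement.YM3TorusSU2 ↔
      ∃ γ₁ : ℝ, 0 < γ₁ ∧ ∀ (F : T3Family) (γ : ℝ), 0 < γ → γ ≤ γ₁ →
        ∃ (b₀ p₀ : ℝ) (n₀ : ℕ) (δ : ℕ → ℝ), Tendsto δ atTop (𝓝 0) ∧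
          (∀ n K : ℕ, n₀ ≤ n → (gibbsK (F.refine n) ℰp (γ * ((F.L : ℝ)⁻¹) ^ n) K).real
            (histGood (F.refine n) ℰp (θBal (F.refine n).L (γ * ((F.L : ℝ)⁻¹) ^ n) b₀ p₀) K 0)ᶜ ≤ δ n) ∧
          ∀ n : ℕ, n₀ ≤ n → ∀ (Cs : List (ULoop3 F)) (ε : ℝ), 0 < ε → ∃ M : ℕ, ∀ K K', M ≤ K → M ≤ K' →
            |(⨍ u, coarseObs F n ℰp Cs u ∂Measure.map (unitA (F.refine n) ℰp K)
                ((gibbsK (F.refine n) ℰp (γ * ((F.L : ℝ)⁻¹) ^ n) K).restrict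
                  (histGood (F.refine n) ℰp (θBal (F.refine n).L (γ * ((F.L : ℝ)⁻¹) ^ n) b₀ p₀) K 0))) -
              ⨍ u, coarseObs F n ℰp Cs u ∂Measure.map (unitA (F.refine n) ℰp K')
                ((gibbsK (F.refine n) ℰp (γ * ((F.L : ℝ)⁻¹) ^ n) K').restrict
                  (histGood (F.refine n) ℰp (θBal (F.refine n).L (γ * ((F.L : ℝ)⁻¹) ^ n) b₀ p₀) K' 0))| ≤ 4 * δ n + ε := by
  constructor
  · rintro ⟨γ₀, hγ₀, hE3⟩
    refine ⟨γ₀, hγ₀, fun F γ hγ hγγ₀ => ?_⟩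
    obtain ⟨b₀, p₀, γ₁, -, -, hγ₁, hM'⟩ := hM F.L
    obtain ⟨δ, hδ, hmass⟩ := hM' F γ rfl hγ
    obtain ⟨n₀, hle⟩ := WideningOfTiltAndMass.exists_depth_le F hγ hγ₁
    have hmass' : ∀ n K : ℕ, n₀ ≤ n → (gibbsK (F.refine n) ℰp (γ * ((F.L : ℝ)⁻¹) ^ n) K).real
        (histGood (F.refine n) ℰp (θBal (F.refine n).L (γ * ((F.L : ℝ)⁻¹) ^ n) b₀ p₀) K 0)ᶜ ≤ δ n :=
      fun n K hn => hmass n K (hle n hn)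
    exact ⟨b₀, p₀, n₀, δ, hδ, hmass',
      (continuumYM3Torus_iff_condOscillation F hγ n₀ hδ hmass').mp (hE3 F γ hγ hγγ₀)⟩
  · rintro ⟨γ₀, hγ₀, h⟩
    refine ⟨γ₀, hγ₀, fun F γ hγ hγγ₀ => ?_⟩
    obtain ⟨b₀, p₀, n₀, δ, hδ, hmass, hosc⟩ := h F γ hγ hγγ₀
    exact (continuumYM3Torus_iff_condOscillation F hγ n₀ hδ hmass).mpr hosc

/-- **THE WEAKEST ASSEMBLING TEXT, AS A CLOSER**: «below some `γ₁ > 0`, every family and coupling carry a profile, a depth, ONE vanishing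
`K`-uniform all-heights complement mass along refinement AND approximately-Cauchy (defect `4·δ n`) conditional expectations of every loop
product given all-heights UV-small history» ⇒ `YM3TorusSU2` (the «⇐» half of `ym3TorusSU2_iff_massAndCondOscillation`; by that theorem
this hypothesis is also NECESSARY once r3 holds).  CONDITIONAL; no crux, no summit, no mass gap. [cite: King1986, Thm 3.4 (3.9)-(3.13) p.656] -/
theorem ym3TorusSU2_of_massAndCondOscillation
    (h : ∃ γ₁ : ℝ, 0 < γ₁ ∧ ∀ (F : T3Family) (γ : ℝ), 0 < γ → γ ≤ γ₁ →
      ∃ (b₀ p₀ : ℝ) (n₀ : ℕ) (δ : ℕ → ℝ), Tendsto δ atTop (𝓝 0) ∧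
        (∀ n K : ℕ, n₀ ≤ n → (gibbsK (F.refine n) ℰp (γ * ((F.L : ℝ)⁻¹) ^ n) K).real
          (histGood (F.refine n) ℰp (θBal (F.refine n).L (γ * ((F.L : ℝ)⁻¹) ^ n) b₀ p₀) K 0)ᶜ ≤ δ n) ∧
        ∀ n : ℕ, n₀ ≤ n → ∀ (Cs : List (ULoop3 F)) (ε : ℝ), 0 < ε → ∃ M : ℕ, ∀ K K', M ≤ K → M ≤ K' →
          |(⨍ u, coarseObs F n ℰp Cs u ∂Measure.map (unitA (F.refine n) ℰp K)
              ((gibbsK (F.refine n) ℰp (γ * ((F.L : ℝ)⁻¹) ^ n) K).restrict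
                (histGood (F.refine n) ℰp (θBal (F.refine n).L (γ * ((F.L : ℝ)⁻¹) ^ n) b₀ p₀) K 0))) -
            ⨍ u, coarseObs F n ℰp Cs u ∂Measure.map (unitA (F.refine n) ℰp K')
              ((gibbsK (F.refine n) ℰp (γ * ((F.L : ℝ)⁻¹) ^ n) K').restrict
                (histGood (F.refine n) ℰp (θBal (F.refine n).L (γ * ((F.L : ℝ)⁻¹) ^ n) b₀ p₀) K' 0))| ≤ 4 * δ n + ε) :
    Literature.MathematicalPhysics.QuantumFieldTheory.Balaban1983to89.T3YM3TorusStatement.YM3TorusSU2 := by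
  obtain ⟨γ₀, hγ₀, h⟩ := h
  refine ⟨γ₀, hγ₀, fun F γ hγ hγγ₀ => ?_⟩
  obtain ⟨b₀, p₀, n₀, δ, hδ, hmass, hosc⟩ := h F γ hγ hγγ₀
  exact (continuumYM3Torus_iff_condOscillation F hγ n₀ hδ hmass).mpr hosc

end Leaf

end Summit.QuantumFields.YangMills.Theorems.WideningSmallFieldIff

end
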